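import Summits.QuantumAdvantage.QuantumAdvantage.Theorems.PurityDialLawL

/-! # PurityDialLaw — part 13/13 (mechanical split for landing of `PurityDialLaw`; content verbatim; scopes re-opened with their variables) -/

set_option linter.dupNamespace false
noncomputable section

namespace Summit.QuantumAdvantage.QuantumAdvantage.Theorems.PurityDialLaw
open Classical Finset Summit.QuantumAdvantage.AdviceFreeQNC0
open Literature.Computability.MetaComplexity Literature.Computability.MetaComplexity.Smolensky
open Literature.Computability.Complexity (parityFn)

section Records

variable {m : ℕ}

/-- **WITNESS (first rung of item 29180, PROVED).**  The relative-Smolensky law HOLDS ON THE SYMMETRIC CLASS with a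
quadratic·log threshold: for every odd prime `p`, every `j`, every weight-determined Boolean `f` of `𝔽_p`-degree
`≤ d < p^j` on `m ≥ 2p^{2j}(log₂ p^j + 3)` bits is `3`-balanced — the regime of 29180 (`m ≥ A(d+1)²`) up to the
factor `2p²·log` (take `p^{j−1} ≤ d`), on the class containing every known extremiser; no case of the blocker 28532
or of the leaf is known in this regime. -/
theorem relSmolOdd_symmetric_witness (p : ℕ) [Fact p.Prime] (hp2 : p ≠ 2) (j : ℕ) {d : ℕ} (hd : d < p ^ j)
    (hm : 2 * (p ^ j) ^ 2 * (Nat.log 2 (p ^ j) + 3) ≤ m) (f : (Fin m → Bool) → Bool)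
    (hsym : WtDetermined f) (hf : HasDegF p f d) :
    (univ.filter fun z : Fin m → Bool => f z = true ∧ parityFn m z = true).card ≤
        3 * (univ.filter fun z : Fin m → Bool => f z = true ∧ parityFn m z = false).card ∧
    (univ.filter fun z : Fin m → Bool => f z = true ∧ parityFn m z = false).card ≤
        3 * (univ.filter fun z : Fin m → Bool => f z = true ∧ parityFn m z = true).card :=
  relBal_three_of_wtDetermined p hp2 j hd hm hsym hf

/-- **WITNESS 2 (PROVED, dimension-free): local thinness.**  For every prime `p` and `d < k`, a Boolean `f` of
`𝔽_p`-degree `≤ d` on `k + r` bits at most half of whose level set lies in `p`-heavy fibres of the leading `k`-block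
satisfies 29180's two inequalities. -/
theorem relSmolOdd_thin_witness (p : ℕ) [Fact p.Prime] {k r d : ℕ} (hd : d < k)
    (f : (Fin (k + r) → Bool) → Bool) (hf : HasDegF p f d)
    (hthin : 2 * ∑ u : Fin r → Bool, (if p ≤ fibreCard f u then fibreCard f u else 0) ≤
      (univ.filter fun z : Fin (k + r) → Bool => f z = true).card) :
    (univ.filter fun z : Fin (k + r) → Bool => f z = true ∧ parityFn (k + r) z = true).card ≤
        3 * (univ.filter fun z : Fin (k + r) → Bool => f z = true ∧ parityFn (k + r) z = false).card ∧
    (univ.filter fun z : Fin (k + r) → Bool => f z = true ∧ parityFn (k + r) z = false).card ≤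
        3 * (univ.filter fun z : Fin (k + r) → Bool => f z = true ∧ parityFn (k + r) z = true).card :=
  relBal_three_of_thin p hd hf hthin

/-- **WITNESS 3 (PROVED, exact): small degree.**  For every prime `p > 2^{k-1}` and `d < k`, a Boolean `f` of
`𝔽_p`-degree `≤ d` on `k + r` bits has EQUAL odd and even parts — 29180's inequalities at ratio `1`, from `m = d + 1`. -/
theorem relSmolOdd_smallDegree_witness (p : ℕ) [Fact p.Prime] {k r d : ℕ} (hd : d < k) (hk : 2 ^ (k - 1) < p)
    (f : (Fin (k + r) → Bool) → Bool) (hf : HasDegF p f d) :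
    (univ.filter fun z : Fin (k + r) → Bool => f z = true ∧ parityFn (k + r) z = true).card =
      (univ.filter fun z : Fin (k + r) → Bool => f z = true ∧ parityFn (k + r) z = false).card :=
  parts_eq_of_pow_lt p hd hk hf

/-- **WITNESS 4 (PROVED): block products.**  For every prime `p` there is `A` (`= 2p²(p+3)+1`) such that every Boolean `f`
in the TENSOR CLOSURE of the weight-determined class — `BlockInv p f`: contains every weight-determined function (`p` odd,
`blockInv_of_wtDetermined`) and every junta on `< 2p²(log₂ p+3)` bits (`blockInv_of_small`), and is closed under conjunction on
disjoint blocks (`blockInv_tensor`), relabelling (`blockInv_permFn`) and negation of inputs (`blockInv_negFn`) — of `𝔽_p`-degree `≤ d` on `m ≥ A(d+1)^4` bits satisfies 29180's two inequalities: the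
dialed law with exponent `B = 4` ON THIS CLASS.  In particular no conjunction of residue readers on disjoint blocks (the
census' tensor-power candidates) is a counterexample to the dialed residual. -/
theorem relSmolOdd_blockProduct_witness (p : ℕ) [Fact p.Prime] :
    ∃ A : ℕ, ∀ m d : ℕ, A * (d + 1) ^ 4 ≤ m → ∀ f : (Fin m → Bool) → Bool, BlockInv p f → HasDegF p f d →
      (univ.filter fun z : Fin m → Bool => f z = true ∧ parityFn m z = true).card ≤
          3 * (univ.filter fun z : Fin m → Bool => f z = true ∧ parityFn m z = false).card ∧
      (univ.filter fun z : Fin m → Bool => f z = true ∧ parityFn m z = false).card ≤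
          3 * (univ.filter fun z : Fin m → Bool => f z = true ∧ parityFn m z = true).card :=
  relSmolLaw_four_of_blockInv p

/-- **WITNESS 4, two-block instance**: for an odd prime `p`, with the same `A`, every conjunction `tensor g h` of two
weight-determined block functions, of degree `≤ d` on `k + r ≥ A(d+1)^4` bits, is `3`-balanced. -/
theorem relSmolOdd_twoBlock_witness (p : ℕ) [Fact p.Prime] (hp2 : p ≠ 2) :
    ∃ A : ℕ, ∀ k r d : ℕ, A * (d + 1) ^ 4 ≤ k + r → ∀ (g : (Fin k → Bool) → Bool) (h : (Fin r → Bool) → Bool),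
      WtDetermined g → WtDetermined h → HasDegF p (tensor g h) d → RelBal 3 (tensor g h) := by
  obtain ⟨A, hA⟩ := relSmolLaw_four_of_blockInv p
  exact ⟨A, fun k r d hm g h hg hh hf =>
    hA (k + r) d hm (tensor g h) (blockInv_tensor p (blockInv_of_wtDetermined p hp2 hg) (blockInv_of_wtDetermined p hp2 hh)) hf⟩

/-- **WITNESS 5 (PROVED, degree-free): disjunctions.**  For `k, r ≥ 1` and ARBITRARY block functions `g`, `h`, the
disjunction `bor g h` on `k + r` bits satisfies 29180's two inequalities — no member of the dial has a disjunction over a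
non-trivial block split as a counterexample. -/
theorem relSmolOdd_disjunction_witness {k r : ℕ} (hk : 1 ≤ k) (hr : 1 ≤ r) (g : (Fin k → Bool) → Bool)
    (h : (Fin r → Bool) → Bool) :
    (univ.filter fun z : Fin (k + r) → Bool => bor g h z = true ∧ parityFn (k + r) z = true).card ≤
        3 * (univ.filter fun z : Fin (k + r) → Bool => bor g h z = true ∧ parityFn (k + r) z = false).card ∧
    (univ.filter fun z : Fin (k + r) → Bool => bor g h z = true ∧ parityFn (k + r) z = false).card ≤
        3 * (univ.filter fun z : Fin (k + r) → Bool => bor g h z = true ∧ parityFn (k + r) z = true).card :=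
  relBal_three_bor hk hr g h

/-- **WITNESS 6 (PROVED): dense level sets at the QUADRATIC threshold.**  For an odd prime `p`, every `f` of degree `≤ d`
on `m ≥ (d+1)²·4^{k+1}` bits whose level set has density `≥ 2^{-k}` satisfies 29180's two inequalities — i.e. 29180 holds
with ITS OWN exponent `B = 2` for all level sets of density `≥ 2/√A`. -/
theorem relSmolOdd_dense_witness {m : ℕ} (p : ℕ) [Fact p.Prime] (hp2 : p ≠ 2) {d k : ℕ}
    (hm : (d + 1) ^ 2 * 4 ^ (k + 1) ≤ m) (f : (Fin m → Bool) → Bool) (hf : HasDegF p f d)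
    (hdense : 2 ^ m ≤ 2 ^ k * (univ.filter fun z => f z = true).card) :
    (univ.filter fun z : Fin m → Bool => f z = true ∧ parityFn m z = true).card ≤
        3 * (univ.filter fun z : Fin m → Bool => f z = true ∧ parityFn m z = false).card ∧
    (univ.filter fun z : Fin m → Bool => f z = true ∧ parityFn m z = false).card ≤
        3 * (univ.filter fun z : Fin m → Bool => f z = true ∧ parityFn m z = true).card :=
  relBal_three_of_dense hp2 hm hf hdense

/-- **WITNESS 7 (PROVED): functions of `K` linear forms `mod p` — the first SPARSE ASYMMETRIC class.**  For an odd
prime `p`, `K` forms with ARBITRARY coefficients and any `φ`, the function `u ↦ φ(ℓ_1(u), …, ℓ_K(u))` of degree `≤ d`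
on `m ≥ 2p²(d + 1 + K(log₂ p + 1))` bits satisfies 29180's two inequalities (threshold LINEAR in `d`; by
`relSmolLaw_one_ofForms` the law holds on this class with `B = 1`, `A = 2p²(1 + K(log₂ p + 1))`). -/
theorem relSmolOdd_linearForms_witness {m : ℕ} (p : ℕ) [Fact p.Prime] (hp2 : p ≠ 2) {K d : ℕ}
    (lam : Fin K → Fin m → ZMod p) (φ : (Fin K → ZMod p) → Bool) (hf : HasDegF p (ofForms lam φ) d)
    (hm : 2 * p ^ 2 * (d + 1 + K * (Nat.log 2 p + 1)) ≤ m) :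
    (univ.filter fun z : Fin m → Bool => ofForms lam φ z = true ∧ parityFn m z = true).card ≤
        3 * (univ.filter fun z : Fin m → Bool => ofForms lam φ z = true ∧ parityFn m z = false).card ∧
    (univ.filter fun z : Fin m → Bool => ofForms lam φ z = true ∧ parityFn m z = false).card ≤
        3 * (univ.filter fun z : Fin m → Bool => ofForms lam φ z = true ∧ parityFn m z = true).card :=
  relBal_three_ofForms p hp2 lam φ hf hm

/-- **WITNESS 8 (PROVED): block-weight functions with an ARBITRARY combiner** (the census classifier's
BLOCK-SYMMETRIC class; `K` consecutive blocks of sizes `ks`, `m = bsum ks`): 29180's two inequalities hold past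
`2(p·max d 1)²(d + 1 + K(log₂(p·max d 1) + 1))` — polynomial in `d`, linear in `K`. -/
theorem relSmolOdd_blockWt_witness (p : ℕ) [Fact p.Prime] (hp2 : p ≠ 2) {d : ℕ} (ks : List ℕ)
    (f : (Fin (bsum ks) → Bool) → Bool) (hf : f ∈ blockWtClass ks) (hdeg : HasDegF p f d)
    (hm : 2 * (p * max d 1) ^ 2 * (d + 1 + ks.length * (Nat.log 2 (p * max d 1) + 1)) ≤ bsum ks) :
    (univ.filter fun z : Fin (bsum ks) → Bool => f z = true ∧ parityFn (bsum ks) z = true).card ≤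
        3 * (univ.filter fun z : Fin (bsum ks) → Bool => f z = true ∧ parityFn (bsum ks) z = false).card ∧
    (univ.filter fun z : Fin (bsum ks) → Bool => f z = true ∧ parityFn (bsum ks) z = false).card ≤
        3 * (univ.filter fun z : Fin (bsum ks) → Bool => f z = true ∧ parityFn (bsum ks) z = true).card :=
  relBal_three_of_blockWt' p hp2 ks f hf hdeg hm

/-- **WITNESS 9 (PROVED): functions of `K` polynomial TESTS of degree `≤ e` modulo ANY odd `q`** (the POLYNOMIAL-RANK
class; `T_j ∈ TwoModuli.degLE (ZMod q) (Fin m) e`, arbitrary combiner `φ`): 29180's two inequalities hold past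
`2q²(q·2^q)^{e−1}·(d + 1 + K(log₂ q + 1))` — linear in `d` and `K` for fixed `(q, e)` (Green–Roy–Straubing / Bourgain). -/
theorem relSmolOdd_polyTests_witness (p : ℕ) [Fact p.Prime] {q : ℕ} [NeZero q] (hq2 : q.Coprime 2) {m K d e : ℕ}
    (he : 1 ≤ e) (T : Fin K → (Fin m → Bool) → ZMod q) (hT : ∀ j, T j ∈ TwoModuli.degLE (ZMod q) (Fin m) e)
    (φ : (Fin K → ZMod q) → Bool) (hf : HasDegF p (ofTests T φ) d)
    (hm : 2 * q ^ 2 * (q * 2 ^ q) ^ (e - 1) * (d + 1 + K * (Nat.log 2 q + 1)) ≤ m) :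
    (univ.filter fun z : Fin m → Bool => ofTests T φ z = true ∧ parityFn m z = true).card ≤
        3 * (univ.filter fun z : Fin m → Bool => ofTests T φ z = true ∧ parityFn m z = false).card ∧
    (univ.filter fun z : Fin m → Bool => ofTests T φ z = true ∧ parityFn m z = false).card ≤
        3 * (univ.filter fun z : Fin m → Bool => ofTests T φ z = true ∧ parityFn m z = true).card :=
  relBal_three_ofTests p hq2 he T hT φ hf hm

/-- **WITNESS 10 (PROVED, UNCONDITIONAL): every Boolean combination of `K` polynomial tests of degree `≤ e` over `𝔽_p`**
(`p` an odd prime, `T_j ∈ lowDeg (ZMod p) m e`) satisfies 29180's two inequalities past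
`2p²(p·2^p)^{e−1}·(K e (p−1) + 1 + K(log₂ p + 1))` — no degree hypothesis (`hasDegF_ofTests` supplies `d = K e (p−1)`). -/
theorem relSmolOdd_polyTests_self_witness (p : ℕ) [Fact p.Prime] (hp2 : p ≠ 2) {m K e : ℕ} (he : 1 ≤ e)
    (T : Fin K → (Fin m → Bool) → ZMod p) (hT : ∀ j, T j ∈ lowDeg (ZMod p) m e) (φ : (Fin K → ZMod p) → Bool)
    (hm : 2 * p ^ 2 * (p * 2 ^ p) ^ (e - 1) * (K * (e * (p - 1)) + 1 + K * (Nat.log 2 p + 1)) ≤ m) :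
    (univ.filter fun z : Fin m → Bool => ofTests T φ z = true ∧ parityFn m z = true).card ≤
        3 * (univ.filter fun z : Fin m → Bool => ofTests T φ z = true ∧ parityFn m z = false).card ∧
    (univ.filter fun z : Fin m → Bool => ofTests T φ z = true ∧ parityFn m z = false).card ≤
        3 * (univ.filter fun z : Fin m → Bool => ofTests T φ z = true ∧ parityFn m z = true).card :=
  relBal_three_ofTests_self p hp2 he T hT φ hm

/-- **the dial, summarised for item 29180** (every prime `p ≥ 5`): linear thresholds fail for every ratio, the
purity threshold `2d` fails for every ratio, the exponential threshold holds at ratio `3`, and 29180 implies the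
dialed residual. -/
theorem relSmolOdd_dial (p : ℕ) [Fact p.Prime] (hp : 5 ≤ p) :
    (∀ R : ℕ, ¬ LawAt p R (fun d => 2 * d)) ∧ (∀ R B : ℕ, B ≤ 1 → ¬ RelSmolLaw p R B) ∧
      LawAt p 3 (fun d => (d + 1) ^ 2 * 4 ^ (d + 1)) ∧
      (Theses.PolyFeatureDial.RelSmolOdd → ∀ (p : ℕ) [Fact p.Prime], 5 ≤ p → ∃ B : ℕ, RelSmolLaw p 3 B) :=
  ⟨(purityDial_summary p (by omega)).1, (purityDial_summary p (by omega)).2.1,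
    (purityDial_summary p (by omega)).2.2, relSmolPolyOdd_of_tree⟩

end Records

end Summit.QuantumAdvantage.QuantumAdvantage.Theorems.PurityDialLaw
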